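import Summits.CriticalPhenomena.PercolationContinuityZ3.Theorems.PercNearOneGluingNoHeavyLowerTailSahiPivotFamily
import Mathlib
import HarnessLib

/-!
# `NoHeavyLowerTail` (crux stmt-CriticalPhenomena-4575), master-family line P1 (gen 15), companion to `…SahiPivotFamily`:
# the transfer principle (facet domination) holds EXACTLY when there is nothing to transfer — the rainbow-free case, PROVED

Support file (seat `prim-masterthm-p1`, gen 15; `--supports stmt-CriticalPhenomena-4575`).  No definitions, no `sorry`, standard axioms.
Memo `run/shared/lean/prim/prim-masterthm/FROM-prim-masterthm-p1-g15-PIVOT-FAMILY.md` §9.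

The conjectured transfer principle of the pivot family ("facet domination": `Ψ^U_U(F) ≤ Ψ^S_U(F)` for `U ⊆ S`; its case
`S = U ∪ {e}` is `LowerSectionDomination`) compares, pivot by pivot, the Gladkov pair weight of a SUB-cube with that of a bigger cube
(capacity of polar pivots) and the rainbow-completing pairs of the two cubes (cost of petal pivots).  This file proves:
* `antipodalSum_self_mono` — the capacity side is monotone in the cube: for a sunflower labeling `F` and `M ⊆ M'`,
  `Σ_{X ⊆ M} κ(F X, F(M∖X)) ≤ Σ_{X ⊆ M'} κ(F X, F(M'∖X))` (iterate the antipodal-Harris rectangle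
  `C(g,h)+C(h,g) ≥ C(g,g)+C(h,h)` of the tree's `kappa_submod` together with `antipodalSum_self_nonneg` for the upper section);
* `facetDomination_of_rainbowFree` — hence facet domination (and lower-section domination, and with it the whole family)
  HOLDS for every sunflower labeling that is RAINBOW-FREE on the pivot cube, i.e. whose tripartitions with pivot in `U` never carry three
  different petals (in particular whenever at most two petal values occur at all): then every petal pivot costs `0` on both sides and
  every polar pivot gains.
So the open content of the transfer principle is exactly the compensation of the rainbow terms (memo §9: the `(B→Cⱼ, Cₗ)` pairs created
by petal upgrades); this is the kernel form of "the difficulty is cubic, not quadratic". [this work]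
-/

namespace Summit.CriticalPhenomena.PercolationContinuityZ3.Theorems

namespace SahiPivotFamily

open Finset AntipodalStrongHarris AntipodalStrongHarris.Lab

variable {k : ℕ} {α : Type*} [DecidableEq α]

/-- **One-step cube monotonicity of the diagonal antipodal sum.**  For a sunflower labeling `F` and `e ∉ M`,
`Σ_{X ⊆ M} κ(F X, F(M∖X)) ≤ Σ_{X ⊆ M ∪ {e}} κ(F X, F((M∪{e})∖X))`: split the bigger sum along `e` (`antipodalSum_insert`) into the two
skew sums of the sections `g = F ≤ h = F(· ∪ {e})`, bound them below termwise by `C(g,g) + C(h,h)` (`kappa_submod`), and drop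
`C(h,h) ≥ 0` (`antipodalSum_self_nonneg`). [this work] -/
theorem antipodalSum_self_le_insert (M : Finset α) {e : α} (he : e ∉ M) (F : Finset α → Lab k)
    (hF : ∀ ⦃X Y : Finset α⦄, X ⊆ Y → F X ≤ F Y) :
    antipodalSum M F F ≤ antipodalSum (insert e M) F F := by
  rw [antipodalSum_insert he]
  have hmono := monotone_comp_insert hF e
  have key : antipodalSum M F F + antipodalSum M (fun X => F (insert e X)) (fun X => F (insert e X)) ≤
      antipodalSum M F (fun X => F (insert e X)) + antipodalSum M (fun X => F (insert e X)) F := by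
    unfold antipodalSum
    rw [← sum_add_distrib, ← sum_add_distrib]
    refine sum_le_sum fun X _ => ?_
    have h1 : F X ≤ F (insert e X) := hF (subset_insert e X)
    have h2 : F (M \ X) ≤ F (insert e (M \ X)) := hF (subset_insert e _)
    have := kappa_submod h1 h2
    linarith
  have hh := antipodalSum_self_nonneg M (fun X => F (insert e X)) hmono
  linarith

/-- **Cube monotonicity of the diagonal antipodal sum**: for a sunflower labeling `F` and `M ⊆ M'`,
`Σ_{X ⊆ M} κ(F X, F(M∖X)) ≤ Σ_{X ⊆ M'} κ(F X, F(M'∖X))` (the Gladkov pair weight of a cube dominates that of its sub-cubes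
through the bottom corner). [this work] -/
theorem antipodalSum_self_mono {M M' : Finset α} (hMM' : M ⊆ M') (F : Finset α → Lab k)
    (hF : ∀ ⦃X Y : Finset α⦄, X ⊆ Y → F X ≤ F Y) :
    antipodalSum M F F ≤ antipodalSum M' F F := by
  -- induction on the difference `M' \ M`
  suffices h : ∀ (J : Finset α), Disjoint J M → antipodalSum M F F ≤ antipodalSum (M ∪ J) F F by
    have hd : Disjoint (M' \ M) M := disjoint_sdiff_self_left
    have := h (M' \ M) hd
    rwa [union_sdiff_of_subset hMM'] at this
  intro J
  induction J using Finset.induction_on with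
  | empty => intro _; simp
  | insert a J ha ih =>
    intro hdis
    have hdis' : Disjoint J M := (disjoint_insert_left.mp hdis).2
    have haM : a ∉ M := (disjoint_insert_left.mp hdis).1
    have h1 := ih hdis'
    have h2 : a ∉ M ∪ J := by
      rw [mem_union, not_or]; exact ⟨haM, ha⟩
    have h3 := antipodalSum_self_le_insert (M ∪ J) h2 F hF
    rw [union_insert]
    exact le_trans h1 h3

/-- **Facet domination in the rainbow-free case (PROVED).**  Let `F` be a sunflower labeling and `U ⊆ S`.  If no tripartition of
`S` with pivot in `U` is a rainbow — precisely: `rainbow (F W) (F X) (F Y) = 0` for all `W ⊆ U` and all `X, Y` — then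
`Ψ^U_U(F) ≤ Ψ^S_U(F)`: petal pivots cost nothing on either side, and each polar pivot's capacity grows with its cube
(`antipodalSum_self_mono`).  E.g. every labeling using at most two petal values.  The general (rainbow) case is the open conjecture
`FacetDomination` of the companion file. [this work] -/
theorem facetDomination_of_rainbowFree (S U : Finset α) (hUS : U ⊆ S) (F : Finset α → Lab k)
    (hF : ∀ ⦃X Y : Finset α⦄, X ⊆ Y → F X ≤ F Y)
    (hR : ∀ W ∈ U.powerset, ∀ X Y : Finset α, rainbow (F W) (F X) (F Y) = 0) :
    pivotSum U U F ≤ pivotSum S U F := by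
  unfold pivotSum
  refine sum_le_sum fun W hW => ?_
  have hWU : W ⊆ U := mem_powerset.mp hW
  rcases polar_eq_zero_or_one (F W) with hp | hp
  · -- petal pivot: both inner sums vanish
    have h0 : ∀ (M : Finset α), ∑ X ∈ M.powerset, lam (F W) (F X) (F (M \ X)) = 0 := fun M =>
      sum_eq_zero fun X _ => by rw [lam_of_not_polar hp, hR W hW, neg_zero]
    rw [h0 (U \ W), h0 (S \ W)]
  · -- polar pivot: `3 C` is monotone in the cube
    have h3 : ∀ (M : Finset α), ∑ X ∈ M.powerset, lam (F W) (F X) (F (M \ X)) = 3 * antipodalSum M F F := fun M => by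
      rw [antipodalSum, mul_sum]; exact sum_congr rfl fun X _ => lam_of_polar hp _ _
    rw [h3 (U \ W), h3 (S \ W)]
    have hsub : U \ W ⊆ S \ W := sdiff_subset_sdiff hUS subset_rfl
    have := antipodalSum_self_mono hsub F hF
    linarith

/-- **Lower-section domination in the rainbow-free case (PROVED)** — the member `S ⊆ S ∪ {e}` of the previous theorem:
`Ψ^S_S(F) ≤ Ψ^{S∪{e}}_S(F)` whenever no tripartition with pivot in `S` is a rainbow. [this work] -/
theorem lowerSectionDomination_of_rainbowFree (S : Finset α) (e : α) (F : Finset α → Lab k)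
    (hF : ∀ ⦃X Y : Finset α⦄, X ⊆ Y → F X ≤ F Y)
    (hR : ∀ W ∈ S.powerset, ∀ X Y : Finset α, rainbow (F W) (F X) (F Y) = 0) :
    pivotSum S S F ≤ pivotSum (insert e S) S F :=
  facetDomination_of_rainbowFree (insert e S) S (subset_insert e S) F hF hR

omit [DecidableEq α] in
/-- **A sufficient condition for rainbow-freeness: at most two petal values occur.**  If every petal value taken by `F` is one of two
fixed petals `Cᵢ, Cⱼ`, then no triple of values of `F` is a rainbow (a rainbow needs three pairwise different petals). [this work] -/
theorem rainbow_eq_zero_of_two_petals {i j : Fin k} (F : Finset α → Lab k)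
    (h2 : ∀ X : Finset α, ∀ l : Fin k, F X = petal l → l = i ∨ l = j) (W X Y : Finset α) :
    rainbow (F W) (F X) (F Y) = 0 := by
  rcases hW : F W with _ | a | _ <;> rcases hX : F X with _ | b | _ <;> rcases hY : F Y with _ | c | _ <;>
    simp only [rainbow]
  -- three petals `a, b, c`, each equal to `i` or `j`: two of them coincide
  have ha := h2 W a hW
  have hb := h2 X b hX
  have hc := h2 Y c hY
  split_ifs with hne
  · obtain ⟨h1, h2', h3⟩ := hne
    rcases ha with rfl | rfl <;> rcases hb with rfl | rfl <;> rcases hc with rfl | rfl <;> simp_all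
  · rfl

end SahiPivotFamily

end Summit.CriticalPhenomena.PercolationContinuityZ3.Theorems
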